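import Summits.ResolutionOfSingularities.ResolutionOfSingularities.Theorems.FrobeniusLadderFRationalResolutionFRationalSurfaceLocal
import Summits.ResolutionOfSingularities.ResolutionOfSingularities.Theorems.FrobeniusLadderFRationalResolutionDiagQuotientNormal
import Literature.AlgebraicGeometry.Resolution.NormalSurfaceSingularLocus
import HarnessLib

/-!
# Crux `FrobeniusLadder.FRationalResolution` (stmt-ResolutionOfSingularities-15317), line `redirect`,
# stub `stub_diagonalizableQuotientResolution` — the SURFACE case reduced to local resolutions at
# finitely many closed singular points

Continuation of `FrobeniusLadderFRationalResolutionDiagQuotientNormal.lean` (the regular-chart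
normality package: under the stub's hypothesis `hq` verbatim, `X` is normal with singular locus in
codimension `≥ 2`). In dimension `≤ 2` this gives the shape in which the landed toric surface
theorems are consumed (`local_resolution_of_toric_stalk`, `hasResolution_fRational_surface_of_local`):

* `hasResolution_normal_surface_of_local` — the gluing theorem of
  `hasResolution_fRational_surface_of_local` with the F-rational clause replaced by what its proof
  uses, NORMALITY (any field `k`): an integral normal surface of finite type over `k` has a
  resolution as soon as every singular point `s` has an open `V ∋ s` containing no other singular
  point and a proper `ρ : Y → V`, `Y` regular, which is an isomorphism over `V ∩ Reg X` with dense
  preimage (`stub_hasResolution_of_local_resolutions`, one point at a time);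
* `diagQuotient_surface_singularLocus` — under `hq` verbatim and `dim X ≤ 2`: the singular locus
  `X ∖ Reg X` is a FINITE set of CLOSED points, each with a local ring of dimension `≥ 2`
  (Literature `finite_compl_regularLocus_of_normal_surface`, `isClosed_singleton_of_not_mem_regularLocus`);
* `stub_diagonalizableQuotientResolution_of_surface_of_local` — **the stub in dimension `≤ 2`
  modulo LOCAL resolutions at its finitely many closed singular points** (binders verbatim, plus
  `dim X ≤ 2` and the local datum `hloc`).

Honest label: a REDUCTION of the dim-`2` slice, not the slice: what remains there is the local
statement «a `2`-dimensional normal local ring carrying an étale chart from `Spec S₀`, `S` regular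
graded by a finite abelian group, has a local resolution in the `hloc` currency» — for Zariski
toric charts `U(r,a)` this is the landed `local_resolution_of_toric_stalk`; the étale-local
linearisation joining the two is open in the tree. No new definitions, no named facts, no sorry.
[folklore; cite: Matsumura1987, Thm. 11.2] [cite: Lipman1978, §2 (finitely many singular points of a normal surface)]
-/

noncomputable section

-- single-problem summit: the doubled namespace component is forced
set_option linter.dupNamespace false

open CategoryTheory AlgebraicGeometry TopologicalSpace
open Literature.AlgebraicGeometry.Resolution

namespace Summit.ResolutionOfSingularities.ResolutionOfSingularities.Theorems.FRationalResolution.DiagQuotientSurface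

/-! ## Gluing local resolutions on a normal surface (any field) -/

/-- **Local resolutions at the singular points of an integral NORMAL surface glue to a
resolution** (every field `k`). For `X` integral, of finite type over `k`, with integrally closed
local rings and `dim X ≤ 2`: if every singular point `s` has an open `V ∋ s` containing no other
singular point and a proper `ρ : Y → V` with `Y` regular which is an isomorphism over `V ∩ Reg X`
with dense preimage, then `X` has a resolution of singularities. (`Reg X` is open and dense, its
complement is finite — `finite_compl_regularLocus_of_normal_surface` — and the local resolutions
are glued one point at a time by `stub_hasResolution_of_local_resolutions`; this is
`hasResolution_fRational_surface_of_local` with the F-rational clause replaced by normality, which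
is all its proof uses.) [folklore] -/
theorem hasResolution_normal_surface_of_local (k : Type) [Field k] (X : Scheme.{0}) [IsIntegral X]
    (f : X ⟶ Spec (.of k)) [LocallyOfFiniteType f] [QuasiCompact f]
    (hN : ∀ x : X, IsIntegrallyClosed (X.presheaf.stalk x)) (hdim : topologicalKrullDim X ≤ 2)
    (hloc : ∀ s : X, s ∉ Scheme.regularLocus X → ∃ (V : X.Opens), s ∈ V ∧
      (∀ t : X, t ∉ Scheme.regularLocus X → t ∈ V → t = s) ∧
      ∃ (Y : Scheme.{0}) (ρ : Y ⟶ V), IsProper ρ ∧ Scheme.IsRegular Y ∧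
        IsIso (ρ ∣_ (V.ι ⁻¹ᵁ ⟨Scheme.regularLocus X, isOpen_regularLocus_of_locallyOfFiniteType_field f⟩)) ∧
        Dense ((ρ ⁻¹ᵁ (V.ι ⁻¹ᵁ ⟨Scheme.regularLocus X,
          isOpen_regularLocus_of_locallyOfFiniteType_field f⟩) : Y.Opens) : Set Y)) :
    Scheme.HasResolution X := by
  classical
  haveI : IsNoetherian X := Scheme.isNoetherian_of_finiteType_over_field f
  -- the open regular locus `U`
  set U : X.Opens := ⟨Scheme.regularLocus X, isOpen_regularLocus_of_locallyOfFiniteType_field f⟩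
    with hU
  have hmemU : ∀ x : X, x ∈ U ↔ IsRegularLocalRing (X.presheaf.stalk x) := fun x => Iff.rfl
  -- `U` is a regular scheme
  have hUreg : Scheme.IsRegular (U : Scheme.{0}) :=
    isRegular_opens_of_stalk U fun x hx => (hmemU x).mp hx
  -- the finitely many singular points
  have hfin : (Scheme.regularLocus X)ᶜ.Finite :=
    Literature.AlgebraicGeometry.Resolution.finite_compl_regularLocus_of_normal_surface f hN hdim
  set S : Finset X := hfin.toFinset with hS
  have hmemS : ∀ x : X, x ∈ S ↔ x ∉ Scheme.regularLocus X := fun x => by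
    rw [hS, Set.Finite.mem_toFinset]; rfl
  have hcov : ∀ x : X, x ∈ U ∨ x ∈ S := fun x => by
    by_cases hx : x ∈ Scheme.regularLocus X
    · exact Or.inl hx
    · exact Or.inr ((hmemS x).mpr hx)
  -- local resolutions, repackaged over `S`
  have hloc' : ∀ s ∈ S, ∃ (V : X.Opens), s ∈ V ∧ (∀ t ∈ S, t ∈ V → t = s) ∧
      ∃ (Y : Scheme.{0}) (ρ : Y ⟶ V), IsProper ρ ∧ Scheme.IsRegular Y ∧
        IsIso (ρ ∣_ (V.ι ⁻¹ᵁ U)) ∧ Dense ((ρ ⁻¹ᵁ (V.ι ⁻¹ᵁ U) : Y.Opens) : Set Y) := by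
    intro s hs
    obtain ⟨V, hsV, hVS, Y, ρ, hρ, hY, hiso, hd⟩ := hloc s ((hmemS s).mp hs)
    exact ⟨V, hsV, fun t ht htV => hVS t ((hmemS t).mp ht) htV, Y, ρ, hρ, hY, hiso, hd⟩
  obtain ⟨X', π, hπ, hX'reg, hiso, hd⟩ :=
    stub_hasResolution_of_local_resolutions X U hUreg S hcov hloc'
  -- `U` is dense: it contains the generic point
  have hgen : genericPoint X ∈ U := by
    refine Literature.AlgebraicGeometry.Resolution.mem_regularLocus_of_ringKrullDim_stalk_le_one hN ?_
    have h0 : ringKrullDim (X.presheaf.stalk (genericPoint X)) = 0 :=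
      ringKrullDim_eq_zero_of_field X.functionField
    rw [h0]; exact zero_le_one
  have hUd : Dense (U : Set X) :=
    U.2.dense ⟨genericPoint X, hgen⟩
  haveI := hπ
  exact ⟨X', π, ⟨inferInstance, ⟨U, hUd, hd, hiso⟩, hX'reg⟩⟩

/-! ## Under the stub's hypothesis: isolated singularities in dimension `≤ 2` -/

/-- **Under `hq` verbatim and `dim X ≤ 2`, `X` has ISOLATED SINGULARITIES**: the singular locus
`X ∖ Reg X` is a finite set of closed points, each with a local ring of dimension `≥ 2` (`X` is
normal by `DiagQuotientNormal.isIntegrallyClosed_stalk_of_hq`; a normal surface of finite type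
over a field has finitely many singular points, all closed, all of codimension `2`).
[cite: Matsumura1987, Thm. 11.2] -/
theorem diagQuotient_surface_singularLocus (k : Type) [Field k] (X : Scheme.{0})
    (g : X ⟶ Spec (.of k)) [IsIntegral X] [LocallyOfFiniteType g] [QuasiCompact g]
    (hq : ∀ x : X, ∃ (A : Type) (_ : AddCommGroup A) (_ : Finite A) (_ : DecidableEq A)
        (S : Type) (_ : CommRing S) (_ : Algebra k S) (𝒮 : A → Submodule k S)
        (_ : GradedAlgebra 𝒮), Algebra.FiniteType k S ∧ IsRegularRing S ∧
        ∃ φ : Spec (.of (𝒮 0)) ⟶ X, Etale φ ∧ x ∈ Set.range φ ∧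
          φ ≫ g = Spec.map (CommRingCat.ofHom (algebraMap k (𝒮 0))))
    (hdim : topologicalKrullDim X ≤ 2) :
    (Scheme.regularLocus X)ᶜ.Finite ∧ ∀ x : X, x ∉ Scheme.regularLocus X →
      IsClosed ({x} : Set X) ∧ (2 : WithBot ℕ∞) ≤ ringKrullDim (X.presheaf.stalk x) := by
  haveI : IsNoetherian X := Scheme.isNoetherian_of_finiteType_over_field g
  have hN : ∀ x : X, IsIntegrallyClosed (X.presheaf.stalk x) :=
    DiagQuotientNormal.isIntegrallyClosed_stalk_of_hq k X g hq
  exact ⟨Literature.AlgebraicGeometry.Resolution.finite_compl_regularLocus_of_normal_surface g hN hdim,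
    fun x hx =>
    ⟨Literature.AlgebraicGeometry.Resolution.isClosed_singleton_of_not_mem_regularLocus hN hdim hx,
      Literature.AlgebraicGeometry.Resolution.two_le_ringKrullDim_stalk_of_not_mem_regularLocus hN hx⟩⟩

/-- **`stub_diagonalizableQuotientResolution` IN DIMENSION `≤ 2`, MODULO LOCAL RESOLUTIONS AT THE
(FINITELY MANY, CLOSED) SINGULAR POINTS** (the stub's binders verbatim, plus `dim X ≤ 2` and the
local datum): if every singular point `s` of `X` has an open `V ∋ s` with no other singular point
and a proper `ρ : Y → V`, `Y` regular, an isomorphism over `V ∩ Reg X` with dense preimage — the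
currency produced for Zariski toric charts by `local_resolution_of_toric_stalk` — then `X` has a
resolution of singularities. [folklore] -/
theorem stub_diagonalizableQuotientResolution_of_surface_of_local (k : Type) [Field k]
    (X : Scheme.{0}) (g : X ⟶ Spec (.of k)) [IsIntegral X] [IsSeparated g]
    [LocallyOfFiniteType g] [QuasiCompact g]
    (hq : ∀ x : X, ∃ (A : Type) (_ : AddCommGroup A) (_ : Finite A) (_ : DecidableEq A)
        (S : Type) (_ : CommRing S) (_ : Algebra k S) (𝒮 : A → Submodule k S)
        (_ : GradedAlgebra 𝒮), Algebra.FiniteType k S ∧ IsRegularRing S ∧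
        ∃ φ : Spec (.of (𝒮 0)) ⟶ X, Etale φ ∧ x ∈ Set.range φ ∧
          φ ≫ g = Spec.map (CommRingCat.ofHom (algebraMap k (𝒮 0))))
    (hdim : topologicalKrullDim X ≤ 2)
    (hloc : ∀ s : X, s ∉ Scheme.regularLocus X → ∃ (V : X.Opens), s ∈ V ∧
      (∀ t : X, t ∉ Scheme.regularLocus X → t ∈ V → t = s) ∧
      ∃ (Y : Scheme.{0}) (ρ : Y ⟶ V), IsProper ρ ∧ Scheme.IsRegular Y ∧
        IsIso (ρ ∣_ (V.ι ⁻¹ᵁ ⟨Scheme.regularLocus X, isOpen_regularLocus_of_locallyOfFiniteType_field g⟩)) ∧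
        Dense ((ρ ⁻¹ᵁ (V.ι ⁻¹ᵁ ⟨Scheme.regularLocus X,
          isOpen_regularLocus_of_locallyOfFiniteType_field g⟩) : Y.Opens) : Set Y)) :
    Scheme.HasResolution X :=
  hasResolution_normal_surface_of_local k X g
    (DiagQuotientNormal.isIntegrallyClosed_stalk_of_hq k X g hq) hdim hloc

end Summit.ResolutionOfSingularities.ResolutionOfSingularities.Theorems.FRationalResolution.DiagQuotientSurface

end
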